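import Summits.ResolutionOfSingularities.ResolutionOfSingularities.Theorems.HilbertSamuelEliminationSigmaMaxModificationsCorridor3WLadderMovingIsoDefs
import HarnessLib

/-!
# [OURS · L1 W4.2] σ-LAYER DEFS, part 1: STRATEGY-PARAMETRISED near steps, reachability and the moving W-top rows —
# with the CJS strategy recovered DEFINITIONALLY (`Iff.rfl` transport)
# (cell res-hironaka, LADDER-RESOLUTION rung L; slot W4.2, crux chain w42 `SigmaMaxModificationsCorridor3`
# stmt-ResolutionOfSingularities-19249 / crux stmt-…-18506; res-L1-w42-plan-1 RULINGS v3.14-3 (BE) 2026-08-27T09:26:26Z,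
# spec `L/w42/sigma_step_spec.md` sha16 7a35e1b7614d46a8 §σ1–σ3; hand res-D-pv-047 AS res-L1-s46-pv-10;
# `--supports stmt-ResolutionOfSingularities-19249 --as helper`)

HONEST FRAMING. Everything here is OURS bookkeeping vocabulary of the w42 chain; NOTHING is a statement of H. Hironaka's
manuscript [Hironaka2017] nor of Cossart–Jannsen–Saito; nothing is asserted beyond definitional unfoldings. WHY (plan of
record, CHAIN w42 v3.14 §0m): the kill test K4.2 CONFIRMED that the non-pointed W-top core row is STUB-FALSE AS TYPED for the
CJS label strategy (k21: an 8-periodic never-isolated walk); since the conjunct `SigmaMaxModificationsCorridor3` asks only for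
SOME terminating modification (no canonicity), the line is re-aimed at rows PARAMETRISED BY A STRATEGY `σ` which names, at
each stage, the admissible (centre, next cycle state) — the CJS procedure being ONE strategy, `Strategy.cjs R`. This file is
the vocabulary only (part 1): every landed CJS-row theorem is recovered as the instance `σ := Strategy.cjs R` by the `Iff.rfl`
transport lemmas of §4; no row of res-type-040 / res-type-012 is touched or restated.

## Contents (namespace `…Theorems.SigmaMaxModificationsCorridor3.Sigma`)

* §1 `Strategy` — a structure with ONE field `step`: for a locally noetherian stage `W`, the level `N`, the value `ν`
  (the data every run of `S(X, ν)` carries), the bookkeeping `L : Labelling W`, `P : Option (Pending W)` of the tree's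
  `CanonicalEliminationSequence.lean`, a centre `C : W.IdealSheafData` and a next cycle state `P' : Option (Pending (blowup C))`,
  the proposition «σ allows the step `(L, P) ↦ (C, P')`». `Strategy.cjs R := ⟨IsCanonicalStep R⟩` (CJS Rem. 6.29 (1) relative
  to the lower-dimensional oracle `R`) — DEFINITIONAL; `Strategy.IsFunctional N ν σ` (at most one `(C, P')` per state; RULINGS
  v3.14-5 (BK) (ii)) with `Strategy.isFunctional_cjs` for a functional oracle.
* §2 `IsAdmissibleStrategy N ν σ` (spec §σ2): every σ-step has a PERMISSIBLE centre (CJS Def. 3.1, tree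
  `IdealSheafData.IsPermissible`) contained in the `ν`-stratum and non-empty while the stratum is, and σ is TOTAL while the
  stratum is non-empty. (That `Strategy.cjs R` is admissible for a functional admissible oracle is a THEOREM of the strata
  layer — tree p503069/p505314 centre lemmas — not restated here.)
* §3 the σ-parametrised copies of the tree's marked-chain vocabulary (`…CampaignW42Tertiary.lean` :141–:345,
  `…Corridor3WLadderMovingDefs.lean` :226, `…MovingIsoDefs.lean` :113), VERBATIM except that `IsCanonicalStep R N ν s.L s.P C P'`
  becomes `σ.step N ν s.L s.P C P'`: `CanonicalNearStepσ`, `Reachesσ`, `InScopeMσ`, `MarkedStage.IsBlownUpσ`,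
  `NoNearChainFromσ`, `NoMovingNearChainFromσ`, `NoWaitingChainFromσ` (fairness), `MaxOriginNoMovingNearChainAtQσ σ p N Q G` (the oracle binder
  `∀ R, OracleFunctional R → OracleAdmissible R →` of the CJS row is REPLACED by the strategy parameter; the origin data
  `∀ ν X x, IsMaximalOrigin … → Q …` is kept), `WtopEvNonIsoMσ σ p Q`.
* §4 TRANSPORT, all by `Iff.rfl`: `canonicalNearStepσ_cjs_iff`, `reachesσ_cjs_iff`, `inScopeMσ_cjs_iff`, `isBlownUpσ_cjs_iff`,
  `noNearChainFromσ_cjs_iff`, `noMovingNearChainFromσ_cjs_iff`, `noWaitingChainFromσ_cjs_iff`,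
  `maxOriginNoMovingNearChainAtQ_iff_forall_cjs`,
  `wtopEvNonIsoM_iff_forall_cjs` — e.g. `WtopEvNonIsoM p Q ↔ ∀ R, OracleFunctional R → OracleAdmissible R →
  WtopEvNonIsoMσ (Strategy.cjs R) p Q`.

## Design points (for res-L1-w42-plan-1's re-cut and V8-b′)

* (D1) `N` and `ν` are ARGUMENTS of `Strategy.step` (the spec's (σ1) writes `σ_CJS R N ν` with `N ν` baked into the strategy;
  moving them into `step` is what makes the ROW-level transport `…AtQ p N Q G ↔ ∀ R …, …AtQσ (Strategy.cjs R) p N Q G`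
  literally `Iff.rfl`, because the CJS rows quantify `ν` INSIDE the oracle binder). A strategy may of course ignore them.
* (D2) The label update `L.next (X_n(ν)) C` and the marked-point clauses of a near step are strategy-INDEPENDENT bookkeeping
  (births of components of the `ν`-stratum) and are kept verbatim; only the choice `(C, P')` is σ's.
* (D3) `step` receives the stage's `IsLocallyNoetherian` instance (explicitly, from `MarkedStage.ln`) so that strategies may
  read Hilbert–Samuel / directrix data stated under it; `Strategy.cjs` ignores it.
* (D4) `IsAdmissibleStrategy` quantifies over ALL locally noetherian stages and bookkeeping states (spec §σ2), not only over
  reachable ones — simpler, and what H-non-increase (CJS Thm. 3.10 (1)) and «iso off `X_max`» consume stage by stage.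

## Not here (later parts / other hands)

`AgreesOffWtopσ` and the re-aimed row (σ5) `∃ σ, IsAdmissibleStrategy 3 ν σ ∧ …` (plan-1 / res-type-040 first refusal after
V8-b′); σ-copies of the strata / births / recognition rows (their authors); `isAdmissibleStrategy_cjs`; any σ-DESIGN (V8-c′).
AI-written; AI review is weaker than expert review.

## References (context only)

* V. Cossart, U. Jannsen, S. Saito, LNM 2270 (2020), Rem. 6.29 (1), Def. 3.1, Thm. 3.10 (1). [CossartJannsenSaito2020]
* M. Spivakovsky, *A solution to Hironaka's polyhedra game*, Progr. Math. 36 (1983) — the model strategy of V8-c′. [Spivakovsky1983]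
-/

noncomputable section

set_option linter.dupNamespace false -- mandated namespace of this single-conjunct summit

open CategoryTheory AlgebraicGeometry TopologicalSpace
open Summit.ResolutionOfSingularities.ResolutionOfSingularities.Theorems.CampaignW42
open Literature.AlgebraicGeometry.Resolution Literature.RingTheory.HilbertSamuel
open Literature.AlgebraicGeometry.CossartJannsenSaito2020
open Summit.ResolutionOfSingularities.ResolutionOfSingularities.Theorems.SigmaMaxModificationsCorridor3.Moving
open Summit.ResolutionOfSingularities.ResolutionOfSingularities.Cruxes.SigmaMaxModifications.IdeasL1Idea2R4 (WtopEvNonIsoM)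

namespace Summit.ResolutionOfSingularities.ResolutionOfSingularities.Theorems.SigmaMaxModificationsCorridor3.Sigma

universe u

/-! ## §1. Strategies -/

/-- [OURS · L1 W4.2] **A STRATEGY `σ`** for runs of `S(X, ν)`-type processes: for every locally noetherian stage `W`, the
level `N` and value `ν` of the run, and the bookkeeping `(L, P)` of the tree's `CanonicalEliminationSequence.lean`
(`Labelling` = birth years of the components of the `ν`-stratum, CJS (6.5); `Pending` = the state of the resolution cycle in
progress), the RELATION `σ.step N ν L P C P'` = «σ allows blowing up the centre `C` and continuing with the cycle state
`P'`». Fully general (no admissibility built in — see `IsAdmissibleStrategy`); the CJS procedure of Rem. 6.29 (1) is the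
instance `Strategy.cjs R`. OURS bookkeeping; NOT a statement of the manuscript. [folklore] -/
structure Strategy : Type (u + 1) where
  /-- «σ allows the step `(L, P) ↦ (C, P')` at level `N`, value `ν`, on the stage `W`» -/
  step : ∀ (W : Scheme.{u}), IsLocallyNoetherian W → ℕ → (ℕ → ℕ) → Labelling W → Option (Pending W) →
    (C : W.IdealSheafData) → Option (Pending (blowup C)) → Prop

/-- [OURS · L1 W4.2] **The CJS strategy `σ_CJS(R)`**: the step relation IS the tree's `IsCanonicalStep R N ν L P C P'`
(CJS Rem. 6.29 (1): between cycles start the cycle of the least non-empty label with the oracle's sequence, inside a cycle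
replay, at its end blow up the whole part) — DEFINITIONAL, so that every σ-notion below specialises to its CJS original by
`Iff.rfl`. [cite: CossartJannsenSaito2020, Rem. 6.29 (1)] -/
def Strategy.cjs (R : ∀ S : Scheme.{u}, CentreSeq S → Prop) : Strategy.{u} :=
  ⟨fun _ _ N ν L P C P' => IsCanonicalStep R N ν L P C P'⟩

/-- Unfolding `Strategy.cjs`. [cite: CossartJannsenSaito2020, Rem. 6.29 (1)] -/
@[simp] theorem Strategy.cjs_step (R : ∀ S : Scheme.{u}, CentreSeq S → Prop) (W : Scheme.{u})
    (hW : IsLocallyNoetherian W) (N : ℕ) (ν : ℕ → ℕ) (L : Labelling W) (P : Option (Pending W))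
    (C : W.IdealSheafData) (P' : Option (Pending (blowup C))) :
    (Strategy.cjs R).step W hW N ν L P C P' ↔ IsCanonicalStep R N ν L P C P' :=
  Iff.rfl

/-- [OURS · L1 W4.2] **`σ` is FUNCTIONAL at level `N`, value `ν`** (RULINGS v3.14-5 (BK) (ii)): from every state `(W, L, P)`
σ allows at most one centre, and for that centre at most one next cycle state — the shape of the tree's
`IsCanonicalStep.centre_unique` / `IsCanonicalStep.pending_unique` (so that the compactness argument
`exists_nearChain_of_canonicalSequenceInfinite_general`, which uses run uniqueness, ports to σ). For `Strategy.cjs R` this is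
`Strategy.isFunctional_cjs` below (functional oracle). OURS; NOT a statement of the manuscript. [folklore] -/
def Strategy.IsFunctional (N : ℕ) (ν : ℕ → ℕ) (σ : Strategy.{u}) : Prop :=
  ∀ (W : Scheme.{u}) (hW : IsLocallyNoetherian W) (L : Labelling W) (P : Option (Pending W)),
    (∀ (C₁ C₂ : W.IdealSheafData) (P₁ : Option (Pending (blowup C₁))) (P₂ : Option (Pending (blowup C₂))),
        σ.step W hW N ν L P C₁ P₁ → σ.step W hW N ν L P C₂ P₂ → C₁ = C₂) ∧
      ∀ (C : W.IdealSheafData) (P₁ P₂ : Option (Pending (blowup C))),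
        σ.step W hW N ν L P C P₁ → σ.step W hW N ν L P C P₂ → P₁ = P₂

/-- [OURS · L1 W4.2] **The CJS strategy of a FUNCTIONAL oracle is functional** («canonical»: the least non-empty label, the
reduced structure on its part, the oracle's sequence and the push-forward are all determined — tree
`IsCanonicalStep.centre_unique`, `IsCanonicalStep.pending_unique`). [cite: CossartJannsenSaito2020, Rem. 6.29 (1)] -/
theorem Strategy.isFunctional_cjs {R : ∀ S : Scheme.{u}, CentreSeq S → Prop} (hR : OracleFunctional R) (N : ℕ)
    (ν : ℕ → ℕ) : (Strategy.cjs R).IsFunctional N ν :=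
  fun _ _ _ _ =>
    ⟨fun _ _ _ _ h₁ h₂ => IsCanonicalStep.centre_unique hR h₁ h₂,
      fun _ _ _ h₁ h₂ => IsCanonicalStep.pending_unique hR h₁ h₂⟩

/-! ## §2. Admissible strategies (spec §σ2) -/

/-- [OURS · L1 W4.2] **`σ` is ADMISSIBLE at level `N`, value `ν`** (spec §σ2): on every locally noetherian stage `W` with
bookkeeping `(L, P)`, (a) every step σ allows has a centre `C` which is (i) PERMISSIBLE (CJS Def. 3.1: regular, `W` normally
flat along it, no component — tree `IdealSheafData.IsPermissible`; this is what gives `H^N` non-increase, CJS Thm. 3.10 (1),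
tree `IsBlowup.hsFun_le_of_isPermissible`), (ii) contained in the `ν`-stratum `W(ν)` (so the blow-up is an isomorphism off
`X_max` when `ν` is maximal), (iii) non-empty as long as `W(ν)` is; and (b) σ is TOTAL: while `W(ν) ≠ ∅` some step is
allowed. OURS; NOT a statement of the manuscript. [cite: CossartJannsenSaito2020, Def. 3.1, Thm. 3.10 (1)] -/
def IsAdmissibleStrategy (N : ℕ) (ν : ℕ → ℕ) (σ : Strategy.{u}) : Prop :=
  ∀ (W : Scheme.{u}) (hW : IsLocallyNoetherian W) (L : Labelling W) (P : Option (Pending W)),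
    (∀ (C : W.IdealSheafData) (P' : Option (Pending (blowup C))), σ.step W hW N ν L P C P' →
        IdealSheafData.IsPermissible C ∧ (C.support : Set W) ⊆ Scheme.hsStratum W N ν ∧
          ((Scheme.hsStratum W N ν).Nonempty → (C.support : Set W).Nonempty)) ∧
      ((Scheme.hsStratum W N ν).Nonempty →
        ∃ (C : W.IdealSheafData) (P' : Option (Pending (blowup C))), σ.step W hW N ν L P C P')

/-! ## §3. σ-parametrised near steps, reachability, blown-up stages and the moving rows -/

/-- [OURS · L1 W4.2] **ONE σ-STEP FOLLOWED AT THE MARKED POINTS** — the tree's `CanonicalNearStep R N ν s s'` with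
`IsCanonicalStep R N ν s.L s.P C P'` replaced by `σ.step … N ν s.L s.P C P'`: σ names `(C, P')` from the state of the stage
`X_n`; the next marked stage is `blowup C` with the UPDATED LABELS `s.L.next (X_n(ν)) C` (strategy-independent bookkeeping of
births, CJS (6.5)), the state `P'`, and a CLOSED marked point `x_{n+1} ↦ x_n` in the `ν`-stratum. NOT a statement of the
manuscript. [folklore] -/
def CanonicalNearStepσ (σ : Strategy.{u}) (N : ℕ) (ν : ℕ → ℕ) (s s' : MarkedStage.{u}) : Prop :=
  ∃ (C : s.W.IdealSheafData) (P' : Option (Pending (blowup C))) (h : IsLocallyNoetherian (blowup C))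
    (x' : ↥(blowup C)),
    σ.step s.W s.ln N ν s.L s.P C P' ∧ (blowup.π C).base x' = s.pt ∧
      IsClosed ({x'} : Set ↥(blowup C)) ∧ x' ∈ Scheme.hsStratum (blowup C) N ν ∧
      s' = ⟨blowup C, h, s.L.next (Scheme.hsStratum s.W N ν) C, P', x'⟩

/-- [OURS · L1 W4.2] `s'` is reached from `s` by finitely many σ-steps followed at marked points (reflexive–transitive
closure; σ-copy of `Reaches`). [folklore] -/
def Reachesσ (σ : Strategy.{u}) (N : ℕ) (ν : ℕ → ℕ) : MarkedStage.{u} → MarkedStage.{u} → Prop :=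
  Relation.ReflTransGen (CanonicalNearStepσ σ N ν)

/-- [OURS · L1 W4.2] In scope for σ: reached along σ from a MAXIMAL origin of characteristic `p` (σ-copy of `InScopeM`).
[folklore] -/
def InScopeMσ (p : ℕ) (σ : Strategy.{u}) (N : ℕ) (ν : ℕ → ℕ) (s : MarkedStage.{u}) : Prop :=
  ∃ (X : Scheme.{u}) (h : IsLocallyNoetherian X) (x : X),
    IsMaximalOrigin p N ν X x ∧ Reachesσ σ N ν (@MarkedStage.init X h x) s

/-- [OURS · L1 W4.2] THE MARKED POINT IS BLOWN UP under σ at this stage: some step σ allows from `(X_n, L, P)` has a centre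
containing `x_n` (σ-copy of `MarkedStage.IsBlownUp`; for a non-functional σ «some», as in the original's `∃`).
[folklore] -/
def _root_.Summit.ResolutionOfSingularities.ResolutionOfSingularities.Theorems.CampaignW42.MarkedStage.IsBlownUpσ
    (σ : Strategy.{u}) (N : ℕ) (ν : ℕ → ℕ) (s : MarkedStage.{u}) : Prop :=
  ∃ (C : s.W.IdealSheafData) (P' : Option (Pending (blowup C))),
    σ.step s.W s.ln N ν s.L s.P C P' ∧ s.pt ∈ (C.support : Set s.W)

/-- [OURS · L1 W4.2] NO INFINITE σ-NEAR CHAIN FROM `s₀` WITHIN THE GRADE `G` (σ-copy of `NoNearChainFrom`). [folklore] -/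
def NoNearChainFromσ (σ : Strategy.{u}) (N : ℕ) (ν : ℕ → ℕ) (s₀ : MarkedStage.{u})
    (G : MarkedStage.{u} → Prop) : Prop :=
  ¬ ∃ c : ℕ → MarkedStage.{u}, Reachesσ σ N ν s₀ (c 0) ∧
      (∀ n, CanonicalNearStepσ σ N ν (c n) (c (n + 1))) ∧ ∀ n, G (c n)

/-- [OURS · L1 W4.2] NO INFINITE MOVING σ-NEAR CHAIN FROM `s₀` WITHIN THE GRADE `G`: no infinite chain of σ-steps reached from
`s₀`, inside `G`, whose marked point is blown up INFINITELY OFTEN (σ-copy of `NoMovingNearChainFrom`). [folklore] -/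
def NoMovingNearChainFromσ (σ : Strategy.{u}) (N : ℕ) (ν : ℕ → ℕ) (s₀ : MarkedStage.{u})
    (G : MarkedStage.{u} → Prop) : Prop :=
  ¬ ∃ c : ℕ → MarkedStage.{u}, Reachesσ σ N ν s₀ (c 0) ∧
      (∀ n, CanonicalNearStepσ σ N ν (c n) (c (n + 1))) ∧ (∀ n, G (c n)) ∧
      ∀ n, ∃ m, n ≤ m ∧ (c m).IsBlownUpσ σ N ν

/-- [OURS · L1 W4.2] NO ETERNALLY WAITING σ-CHAIN FROM `s₀`: no infinite chain of σ-steps reached from `s₀` along which the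
marked point is NEVER blown up (σ-copy of `NoWaitingChainFrom`; the FAIRNESS vocabulary of RULINGS v3.14-5 (BK) (i) /
tri-2 (d3)). [folklore] -/
def NoWaitingChainFromσ (σ : Strategy.{u}) (N : ℕ) (ν : ℕ → ℕ) (s₀ : MarkedStage.{u}) : Prop :=
  ¬ ∃ c : ℕ → MarkedStage.{u}, Reachesσ σ N ν s₀ (c 0) ∧
      (∀ n, CanonicalNearStepσ σ N ν (c n) (c (n + 1))) ∧ ∀ n, ¬ (c n).IsBlownUpσ σ N ν

/-- [OURS · L1 W4.2] **THE MOVING ROW AT `Q`-ORIGINS, FOR THE STRATEGY `σ`** (σ-copy of `MaxOriginNoMovingNearChainAtQ p N Q G`,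
with the oracle binder `∀ R, OracleFunctional R → OracleAdmissible R →` REPLACED by the strategy parameter): for every value
`ν`, every MAXIMAL origin `(X, x)` of characteristic `p` at level `N` (`IsMaximalOrigin`) satisfying `Q N ν X x`, there is no
infinite moving σ-near chain within `G` from `(X, x)`. NOT a statement of the manuscript. [folklore] -/
def MaxOriginNoMovingNearChainAtQσ (σ : Strategy.{u}) (p N : ℕ) (Q : ℕ → (ℕ → ℕ) → ∀ X : Scheme.{u}, X → Prop)
    (G : MarkedStage.{u} → Prop) : Prop :=
  ∀ (ν : ℕ → ℕ) (X : Scheme.{u}) [IsLocallyNoetherian X] (x : X), IsMaximalOrigin p N ν X x → Q N ν X x →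
    NoMovingNearChainFromσ σ N ν (MarkedStage.init X x) G

/-- [OURS · L1 W4.2] **Ev-NonIso FOR THE STRATEGY `σ`** (σ-copy of `WtopEvNonIsoM p Q`, the W-top core row): no moving σ-chain of
grade `ē ≥ 3` none of whose stages is isolated in the Hilbert–Samuel locus, from a stage σ-reachable from a `Q`-maximal origin
at level `3`. The re-aimed row of CHAIN w42 v3.14 (σ5) is `∃ σ, IsAdmissibleStrategy 3 ν σ ∧ … ∧ WtopEvNonIsoMσ σ p QNonpointed`.
NOT a statement of the manuscript. [folklore] -/
def WtopEvNonIsoMσ (σ : Strategy.{u}) (p : ℕ) (Q : ℕ → (ℕ → ℕ) → ∀ X : Scheme.{u}, X → Prop) : Prop :=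
  MaxOriginNoMovingNearChainAtQσ σ p 3 Q fun s => 3 ≤ s.geomDirDim ∧ ¬ Iso 3 s

/-! ## §4. Transport: the CJS strategy recovers the landed vocabulary DEFINITIONALLY -/

section Transport

variable (R : ∀ S : Scheme.{u}, CentreSeq S → Prop) (N : ℕ) (ν : ℕ → ℕ)

/-- `CanonicalNearStepσ (σ_CJS R) = CanonicalNearStep R`, definitionally. [folklore] -/
theorem canonicalNearStepσ_cjs_iff (s s' : MarkedStage.{u}) :
    CanonicalNearStepσ (Strategy.cjs R) N ν s s' ↔ CanonicalNearStep R N ν s s' :=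
  Iff.rfl

/-- `CanonicalNearStepσ (σ_CJS R)` and `CanonicalNearStep R` are the same relation. [folklore] -/
theorem canonicalNearStepσ_cjs_eq : CanonicalNearStepσ (Strategy.cjs R) N ν = CanonicalNearStep R N ν :=
  rfl

/-- `Reachesσ (σ_CJS R) = Reaches R`, definitionally. [folklore] -/
theorem reachesσ_cjs_iff (s s' : MarkedStage.{u}) :
    Reachesσ (Strategy.cjs R) N ν s s' ↔ Reaches R N ν s s' :=
  Iff.rfl

/-- `InScopeMσ p (σ_CJS R) = InScopeM p R`, definitionally. [folklore] -/
theorem inScopeMσ_cjs_iff (p : ℕ) (s : MarkedStage.{u}) :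
    InScopeMσ p (Strategy.cjs R) N ν s ↔ InScopeM p R N ν s :=
  Iff.rfl

/-- `IsBlownUpσ (σ_CJS R) = IsBlownUp R`, definitionally. [folklore] -/
theorem isBlownUpσ_cjs_iff (s : MarkedStage.{u}) :
    s.IsBlownUpσ (Strategy.cjs R) N ν ↔ s.IsBlownUp R N ν :=
  Iff.rfl

/-- `NoNearChainFromσ (σ_CJS R) = NoNearChainFrom R`, definitionally. [folklore] -/
theorem noNearChainFromσ_cjs_iff (s₀ : MarkedStage.{u}) (G : MarkedStage.{u} → Prop) :
    NoNearChainFromσ (Strategy.cjs R) N ν s₀ G ↔ NoNearChainFrom R N ν s₀ G :=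
  Iff.rfl

/-- `NoMovingNearChainFromσ (σ_CJS R) = NoMovingNearChainFrom R`, definitionally. [folklore] -/
theorem noMovingNearChainFromσ_cjs_iff (s₀ : MarkedStage.{u}) (G : MarkedStage.{u} → Prop) :
    NoMovingNearChainFromσ (Strategy.cjs R) N ν s₀ G ↔ NoMovingNearChainFrom R N ν s₀ G :=
  Iff.rfl

/-- `NoWaitingChainFromσ (σ_CJS R) = NoWaitingChainFrom R`, definitionally. [folklore] -/
theorem noWaitingChainFromσ_cjs_iff (s₀ : MarkedStage.{u}) :
    NoWaitingChainFromσ (Strategy.cjs R) N ν s₀ ↔ NoWaitingChainFrom R N ν s₀ :=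
  Iff.rfl

end Transport

/-- **ROW TRANSPORT**: the registered moving row at `Q`-origins IS the σ-row for all CJS strategies `σ_CJS(R)`, `R` functional
admissible — definitionally. [folklore] -/
theorem maxOriginNoMovingNearChainAtQ_iff_forall_cjs (p N : ℕ) (Q : ℕ → (ℕ → ℕ) → ∀ X : Scheme.{u}, X → Prop)
    (G : MarkedStage.{u} → Prop) :
    MaxOriginNoMovingNearChainAtQ p N Q G ↔
      ∀ (R : ∀ S : Scheme.{u}, CentreSeq S → Prop), OracleFunctional R → OracleAdmissible R →
        MaxOriginNoMovingNearChainAtQσ (Strategy.cjs R) p N Q G :=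
  Iff.rfl

/-- **ROW TRANSPORT for the W-top core**: `WtopEvNonIsoM p Q ↔ ∀ R functional admissible, WtopEvNonIsoMσ (σ_CJS R) p Q` —
definitionally; so the k21 verdict on the CJS row and every landed CJS-row theorem read on the σ-row at `σ := σ_CJS(R)`.
[folklore] -/
theorem wtopEvNonIsoM_iff_forall_cjs (p : ℕ) (Q : ℕ → (ℕ → ℕ) → ∀ X : Scheme.{u}, X → Prop) :
    WtopEvNonIsoM p Q ↔
      ∀ (R : ∀ S : Scheme.{u}, CentreSeq S → Prop), OracleFunctional R → OracleAdmissible R →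
        WtopEvNonIsoMσ (Strategy.cjs R) p Q :=
  Iff.rfl

/-- One direction packaged for consumers: a σ-row proved for EVERY CJS strategy gives the registered row. [folklore] -/
theorem wtopEvNonIsoM_of_forall_cjs (p : ℕ) (Q : ℕ → (ℕ → ℕ) → ∀ X : Scheme.{u}, X → Prop)
    (h : ∀ (R : ∀ S : Scheme.{u}, CentreSeq S → Prop), OracleFunctional R → OracleAdmissible R →
      WtopEvNonIsoMσ (Strategy.cjs R) p Q) :
    WtopEvNonIsoM p Q :=
  (wtopEvNonIsoM_iff_forall_cjs p Q).mpr h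

/-! ## §5. SCOPED admissibility (APPEND 2026-08-27 ≈09:55Z, same hand) — VACUITY GUARD for §2

`IsAdmissibleStrategy N ν σ` (§2, spec §σ2 read literally) quantifies its TOTALITY clause over EVERY locally noetherian stage `W`.
That is UNSATISFIABLE for many `(N, ν)`: e.g. for `ν = Φ^{(N)}` (`iterPSum N Phi`) take `W = Spec 𝒪` with `𝒪` a one-dimensional
non-regular local noetherian domain — then `W(ν) = {η}` is the NON-closed generic point (`H^N_W(η) = Φ^{(N)} < H^N_W(𝔪)`), so no
centre `C` (whose support is closed) has `∅ ≠ C.support ⊆ W(ν)`, and clause (b) fails for every `σ`; similar one-more-specialisation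
stages defeat other values `ν`. Rows of the shape `∃ σ, IsAdmissibleStrategy 3 ν σ ∧ …` would therefore be refutable for the wrong
reason. The intended reading (CJS's procedure is only ever run on stages of `S(X, ν)` for `ν` MAXIMAL on an EXCELLENT `X`, where
`X_n(ν)` is closed and regular closed centres inside it are permissible) is admissibility ON A SCOPE of states: this section adds
`IsAdmissibleStrategyOn 𝒮 N ν σ` for an arbitrary state-scope `𝒮`, the natural scope `Strategy.ReachableState p σ N ν` (states
carried by a marked stage σ-reachable from a maximal origin of characteristic `p`), and the bookkeeping lemmas. §2's unscoped
notion is the case `𝒮 = ⊤` and stays as the (strong, possibly vacuous) sufficient condition. -/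

section Scoped

/-- [OURS · L1 W4.2] **`σ` is ADMISSIBLE ON THE STATE-SCOPE `𝒮` at level `N`, value `ν`**: the two clauses of
`IsAdmissibleStrategy` — (a) every allowed step has a permissible centre inside the `ν`-stratum, non-empty while the stratum
is; (b) totality while the stratum is non-empty — demanded only at states `(W, L, P)` with `𝒮 W hW L P`. Use with
`𝒮 := Strategy.ReachableState p σ N ν` (or any scope containing the states a run visits). VACUITY: satisfiable scopes are those
avoiding stages whose non-empty `ν`-stratum contains no non-empty closed permissible centre (module docstring §5).
NOT a statement of the manuscript. [cite: CossartJannsenSaito2020, Def. 3.1, Rem. 6.29 (1)] -/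
def IsAdmissibleStrategyOn
    (𝒮 : ∀ (W : Scheme.{u}), IsLocallyNoetherian W → Labelling W → Option (Pending W) → Prop)
    (N : ℕ) (ν : ℕ → ℕ) (σ : Strategy.{u}) : Prop :=
  ∀ (W : Scheme.{u}) (hW : IsLocallyNoetherian W) (L : Labelling W) (P : Option (Pending W)), 𝒮 W hW L P →
    (∀ (C : W.IdealSheafData) (P' : Option (Pending (blowup C))), σ.step W hW N ν L P C P' →
        IdealSheafData.IsPermissible C ∧ (C.support : Set W) ⊆ Scheme.hsStratum W N ν ∧
          ((Scheme.hsStratum W N ν).Nonempty → (C.support : Set W).Nonempty)) ∧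
      ((Scheme.hsStratum W N ν).Nonempty →
        ∃ (C : W.IdealSheafData) (P' : Option (Pending (blowup C))), σ.step W hW N ν L P C P')

/-- [OURS · L1 W4.2] **The natural scope: states REACHABLE under `σ`** from a maximal origin of characteristic `p` at level `N`,
value `ν` — the state `(W, L, P)` is carried by some marked stage `⟨W, hW, L, P, x⟩` with `InScopeMσ p σ N ν` (for
`σ = Strategy.cjs R`: the states of the stages of `S(X, ν)` reached along near chains from maximal origins). [folklore] -/
def Strategy.ReachableState (p : ℕ) (σ : Strategy.{u}) (N : ℕ) (ν : ℕ → ℕ) :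
    ∀ (W : Scheme.{u}), IsLocallyNoetherian W → Labelling W → Option (Pending W) → Prop :=
  fun W hW L P => ∃ x : W, InScopeMσ p σ N ν ⟨W, hW, L, P, x⟩

variable {N : ℕ} {ν : ℕ → ℕ} {σ : Strategy.{u}}

/-- Unscoped admissibility is admissibility on the scope `⊤`. [folklore] -/
theorem isAdmissibleStrategyOn_top_iff :
    IsAdmissibleStrategyOn (fun _ _ _ _ => True) N ν σ ↔ IsAdmissibleStrategy N ν σ :=
  ⟨fun h W hW L P => h W hW L P trivial, fun h W hW L P _ => h W hW L P⟩

/-- Unscoped admissibility restricts to every scope. [folklore] -/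
theorem IsAdmissibleStrategy.on (h : IsAdmissibleStrategy N ν σ)
    (𝒮 : ∀ (W : Scheme.{u}), IsLocallyNoetherian W → Labelling W → Option (Pending W) → Prop) :
    IsAdmissibleStrategyOn 𝒮 N ν σ :=
  fun W hW L P _ => h W hW L P

/-- Scoped admissibility is antitone in the scope. [folklore] -/
theorem IsAdmissibleStrategyOn.mono
    {𝒮 𝒯 : ∀ (W : Scheme.{u}), IsLocallyNoetherian W → Labelling W → Option (Pending W) → Prop}
    (h : IsAdmissibleStrategyOn 𝒮 N ν σ) (h𝒯 : ∀ W hW L P, 𝒯 W hW L P → 𝒮 W hW L P) :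
    IsAdmissibleStrategyOn 𝒯 N ν σ :=
  fun W hW L P hP => h W hW L P (h𝒯 W hW L P hP)

/-- The state of a σ-reachable marked stage is a reachable state (by definition). [folklore] -/
theorem Strategy.reachableState_of_inScopeMσ {p : ℕ} {s : MarkedStage.{u}} (hs : InScopeMσ p σ N ν s) :
    Strategy.ReachableState p σ N ν s.W s.ln s.L s.P :=
  ⟨s.pt, hs⟩

/-- On a reachable state every step an `ReachableState`-admissible σ allows has a permissible centre inside the
`ν`-stratum, non-empty while the stratum is (clause (a) unpacked at a marked stage). [folklore] -/
theorem IsAdmissibleStrategyOn.step_spec {p : ℕ} (h : IsAdmissibleStrategyOn (Strategy.ReachableState p σ N ν) N ν σ)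
    {s : MarkedStage.{u}} (hs : InScopeMσ p σ N ν s) {C : s.W.IdealSheafData} {P' : Option (Pending (blowup C))}
    (hstep : σ.step s.W s.ln N ν s.L s.P C P') :
    IdealSheafData.IsPermissible C ∧ (C.support : Set s.W) ⊆ Scheme.hsStratum s.W N ν ∧
      ((Scheme.hsStratum s.W N ν).Nonempty → (C.support : Set s.W).Nonempty) :=
  (h s.W s.ln s.L s.P (Strategy.reachableState_of_inScopeMσ hs)).1 C P' hstep

/-- On a reachable state with non-empty `ν`-stratum a `ReachableState`-admissible σ allows some step (clause (b), TOTALITY,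
unpacked at a marked stage). [folklore] -/
theorem IsAdmissibleStrategyOn.exists_step {p : ℕ} (h : IsAdmissibleStrategyOn (Strategy.ReachableState p σ N ν) N ν σ)
    {s : MarkedStage.{u}} (hs : InScopeMσ p σ N ν s) (hne : (Scheme.hsStratum s.W N ν).Nonempty) :
    ∃ (C : s.W.IdealSheafData) (P' : Option (Pending (blowup C))), σ.step s.W s.ln N ν s.L s.P C P' :=
  (h s.W s.ln s.L s.P (Strategy.reachableState_of_inScopeMσ hs)).2 hne

end Scoped

end Summit.ResolutionOfSingularities.ResolutionOfSingularities.Theorems.SigmaMaxModificationsCorridor3.Sigma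

end
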